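import Mathlib
import HarnessLib
import Summits.HubbardSuperconductivity.HubbardSuperconductivity.Theorems.KLProgrammeKLRegimeTwoVolumeLipRemeasureVar
import Summits.HubbardSuperconductivity.HubbardSuperconductivity.Theorems.KLProgrammeKLRegimeEngineTowerLevFloorUnitsDefs
import Summits.HubbardSuperconductivity.HubbardSuperconductivity.Theorems.KLProgrammeKLRegimeEngineTowerBlockIncrWtKitCarrier

/-!
# Route `KLProgramme` — crux K3 ENGINE (stmt-HubbardSuperconductivity-20437 `KLRegimeEngineV17F2`), stub (e) proof-input «(e)-D-ROWS», F-D7c: THE (Dμ) ROW IN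
# TRACK-`0` FLOOR UNITS — the `hrow` shape of `EngineV8.towerDiff_le_of_geomBudget` at the model
# (seat hubbard-kl-k3c4-p1 g25, VL lane; DROWS-SCOPE-g25 §13.6 (row); composes `…TwoVolumeLipRemeasureVar.klLipInputDiffSup_le_remeasured_var` (p722475))

The (Dμ) row of block `k` (`…LipRemeasureVar`, degree `n+1 = 2m`, depth `D₀+r`) bounds the measured two-volume difference by the jump-transferred born differences
of the earlier blocks `k′ < k` (rows `cW k′` of `klJump (bL) (dk−1) (dk′)`) plus sources.  Dividing by the measuring unit `ε·klLevUnitF β M 0 m (dk−1)` of block `k`,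
writing each earlier born difference in ITS unit `ε·klLevUnitF β M 0 m (dk′)` (the array `db (k′+1) m` of the difference tower, `…TwoVolumeLipStepLinkUniform`), and
reading the jump rows through the envelope `cW k′ ≤ C_J·2^{dk−1−dk′}` (one factor `2` per family step: `sectorCount j = 2^{j+1}`), the coefficient of `db (k′+1) m` in
`32·(cW_T²/8)^m·dE_k m` is at most `(2·Z·C_J²)^m·χ_m^{k−k′}` with `Z = cW_T²/8` and the per-block growth **`χ_m = (32/2^m)^d`** (unit ratio `(32/8^m)` and Schur count
`4^m` per family step); everything else — the base (`k′`-free), the block-`0` term (N13), the far parts `τ·klLipBornDiffSup … 0` and the coarse born profiles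
`N`, `N_far` — is the row SOURCE.  This is exactly the `hrow` hypothesis of `towerDiff_le_of_geomBudget` (`a_m = (2ZC_J²)^m`, `χ_m = (32/2^m)^d`, `k″ = k′+1`).

* `jumpCoeff_le` — the arithmetic: `32·Z^m·c^{2m}·klLevUnitF(m, dk′)/klLevUnitF(m, dk−1) ≤ (2ZC_J²)^m·((32/2^m)^d)^{k−k′}` for `c ≤ C_J·2^{dk−1−dk′}`, `1 ≤ k′ < k`;
* **`lipDiffArray_row_le`** — the displayed row at the model.

Compositions of landed theorems and real algebra; nothing asserts the (D) rows, stub (e), VL, K3 or superconductivity.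
References: BGM 2006 §2.7 (2.71), §2.8 (2.93)–(2.98), §3 [cite: BenfattoGiulianiMastropietro2006].
-/

noncomputable section

namespace Summit.HubbardSuperconductivity.HubbardSuperconductivity.Theorems.TwoVolumeLip

set_option linter.dupNamespace false -- summit = problem name (single-conjunct summit), D-0017

open Finset Literature.MathematicalPhysics.QuantumLattice GrassmannAlgebra Literature.Probability.LatticeModels
open Literature.MathematicalPhysics.QuantumLattice.FermiRG
open Summit.HubbardSuperconductivity.HubbardSuperconductivity.Theorems.KLRegimeSplit
open Summit.HubbardSuperconductivity.HubbardSuperconductivity.Theorems.KLProgrammeLegKernels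
open Summit.HubbardSuperconductivity.HubbardSuperconductivity.Theorems.DispersionFlow
open Summit.HubbardSuperconductivity.HubbardSuperconductivity.Theorems.EngineV8
open Summit.HubbardSuperconductivity.HubbardSuperconductivity.Theorems.TwoVolumeSource
open Summit.HubbardSuperconductivity.HubbardSuperconductivity.Theorems.TwoVolumeDefect

/-- **The jump coefficient in floor units** (pure arithmetic; `1 ≤ d`, `k′ < k`, any `m`): if the jump rows of block `k′` into block `k` obey `c ≤ C_J·2^{dk−1−dk′}`,
then `32·Z^m·c^{2m}·klLevUnitF β M 0 m (dk′)/klLevUnitF β M 0 m (dk−1) ≤ (2ZC_J²)^m·((32/2^m)^d)^{k−k′}`. -/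
theorem jumpCoeff_le {β : ℝ} (hβ : 0 < β) {M : ℕ} [NeZero M] {d k k' m : ℕ} (hd : 1 ≤ d) (hk : k' < k)
    {Z CJ c : ℝ} (hZ : 0 ≤ Z) (hc0 : 0 ≤ c) (hc : c ≤ CJ * (2 : ℝ) ^ (d * k - 1 - d * k')) :
    32 * Z ^ m * c ^ (2 * m) * (klLevUnitF β M 0 m (d * k') / klLevUnitF β M 0 m (d * k - 1)) ≤
      (2 * Z * CJ ^ 2) ^ m * (((32 : ℝ) / 2 ^ m) ^ d) ^ (k - k') := by
  -- the jump length `N = dk − 1 − dk′`, `N + 1 = d(k − k′)`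
  set N : ℕ := d * k - 1 - d * k' with hN
  have hkk : d * k' + d ≤ d * k := by rw [← Nat.mul_succ]; exact Nat.mul_le_mul_left d hk
  have hJ : d * k - 1 = d * k' + N := by omega
  have hsub : d * (k - k') + d * k' = d * k := by rw [← Nat.mul_add, Nat.sub_add_cancel hk.le]
  have hN1 : N + 1 = d * (k - k') := by omega
  -- the unit ratio
  have hratio : klLevUnitF β M 0 m (d * k') / klLevUnitF β M 0 m (d * k - 1) = ((32 : ℝ) / 8 ^ m) ^ N := by
    have hU0 : klLevUnitF β M 0 m (d * k') ≠ 0 := (klLevUnitF_pos hβ 0 m _).ne'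
    rw [hJ, klLevUnitF_add]
    unfold klLevRatioF
    rw [show klLevGain 0 = 0 from rfl, pow_zero, mul_one, div_pow, div_pow]
    have h8 : (8 : ℝ) ^ m ≠ 0 := by positivity
    have h8N : ((8 : ℝ) ^ m) ^ N ≠ 0 := by positivity
    field_simp
  -- the rows
  have hcpow : c ^ (2 * m) ≤ CJ ^ (2 * m) * ((4 : ℝ) ^ m) ^ N := by
    calc c ^ (2 * m) ≤ (CJ * (2 : ℝ) ^ N) ^ (2 * m) := pow_le_pow_left₀ hc0 hc _
      _ = CJ ^ (2 * m) * ((4 : ℝ) ^ m) ^ N := by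
          rw [mul_pow, ← pow_mul, ← pow_mul, show (4 : ℝ) = 2 ^ 2 by norm_num, ← pow_mul]
          congr 2; ring
  -- `4^m·(32/8^m) = 32/2^m`
  have hcomb : ((4 : ℝ) ^ m) ^ N * ((32 : ℝ) / 8 ^ m) ^ N = ((32 : ℝ) / 2 ^ m) ^ N := by
    rw [← mul_pow]
    congr 1
    have h8 : (8 : ℝ) ^ m = 4 ^ m * 2 ^ m := by rw [← mul_pow]; norm_num
    rw [h8]
    have h2 : (2 : ℝ) ^ m ≠ 0 := by positivity
    have h4 : (4 : ℝ) ^ m ≠ 0 := by positivity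
    field_simp
  have hstep4 : 32 * Z ^ m * CJ ^ (2 * m) * ((32 : ℝ) / 2 ^ m) ^ N = (2 * Z * CJ ^ 2) ^ m * ((32 : ℝ) / 2 ^ m) ^ (N + 1) := by
    have h2 : (2 : ℝ) ^ m ≠ 0 := by positivity
    have hX : ((32 : ℝ) / 2 ^ m) ^ (N + 1) = ((32 : ℝ) / 2 ^ m) ^ N * 32 / 2 ^ m := by rw [pow_succ]; ring
    have hCJ2 : (CJ ^ 2) ^ m = CJ ^ (2 * m) := by rw [← pow_mul]
    rw [hX, mul_pow, mul_pow, hCJ2]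
    field_simp
  rw [hratio]
  calc 32 * Z ^ m * c ^ (2 * m) * ((32 : ℝ) / 8 ^ m) ^ N
      ≤ 32 * Z ^ m * (CJ ^ (2 * m) * ((4 : ℝ) ^ m) ^ N) * ((32 : ℝ) / 8 ^ m) ^ N := by gcongr
    _ = 32 * Z ^ m * CJ ^ (2 * m) * (((4 : ℝ) ^ m) ^ N * ((32 : ℝ) / 8 ^ m) ^ N) := by ring
    _ = 32 * Z ^ m * CJ ^ (2 * m) * ((32 : ℝ) / 2 ^ m) ^ N := by rw [hcomb]
    _ = (2 * Z * CJ ^ 2) ^ m * ((32 : ℝ) / 2 ^ m) ^ (N + 1) := hstep4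
    _ = (2 * Z * CJ ^ 2) ^ m * (((32 : ℝ) / 2 ^ m) ^ d) ^ (k - k') := by rw [hN1, pow_mul]

/-- **Row bookkeeping** (pure algebra over `range k = {0} ∪ [1,k)`): if `S ≤ B₀ + Σ_{k′<k} (P k′ + Q k′)` with `P, Q ≥ 0`, and for `1 ≤ k′ < k` the main piece in units obeys
`c·P k′/U ≤ a·χ^{k−k′}·db (k′+1)` (`a, χ ≥ 0`, `db ≥ 0`, `c ≥ 0`, `U > 0`), then (the terms `k″ = 0, 1` added on the right are nonnegative)
`c·S/U ≤ Σ_{k″∈[0,k]} a·χ^{k+1−k″}·db k″ + c·(B₀ + (P 0 + Q 0) + Σ_{k′∈[1,k)} Q k′)/U`. -/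
theorem row_units_le {k : ℕ} (hk : 1 ≤ k) {S B₀ c U a χ : ℝ} {P Q db : ℕ → ℝ}
    (hc : 0 ≤ c) (hU : 0 < U) (ha : 0 ≤ a) (hχ : 0 ≤ χ) (hdb0 : ∀ k'', 0 ≤ db k'')
    (hS : S ≤ B₀ + ∑ k' ∈ range k, (P k' + Q k'))
    (hmain : ∀ k', 1 ≤ k' → k' < k → c * P k' / U ≤ a * χ ^ (k - k') * db (k' + 1)) :
    c * S / U ≤ (∑ k'' ∈ range (k + 1), a * χ ^ (k + 1 - k'') * db k'') + c * (B₀ + (P 0 + Q 0) + ∑ k' ∈ Ico 1 k, Q k') / U := by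
  -- split the row at `k′ = 0`
  have hsplit : ∑ k' ∈ range k, (P k' + Q k') = (P 0 + Q 0) + ∑ k' ∈ Ico 1 k, (P k' + Q k') := by
    rw [Finset.range_eq_Ico, Finset.sum_eq_sum_Ico_succ_bot hk]
  have hS' : c * S / U ≤ c * (B₀ + (P 0 + Q 0) + ∑ k' ∈ Ico 1 k, Q k') / U + ∑ k' ∈ Ico 1 k, c * P k' / U := by
    have h1 : c * S / U ≤ c * (B₀ + ((P 0 + Q 0) + ∑ k' ∈ Ico 1 k, (P k' + Q k'))) / U := by
      rw [← hsplit]; exact div_le_div_of_nonneg_right (mul_le_mul_of_nonneg_left hS hc) hU.le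
    refine h1.trans (le_of_eq ?_)
    rw [Finset.sum_add_distrib, ← Finset.sum_div, ← Finset.mul_sum]
    field_simp
    ring
  -- the main pieces against the born differences, re-indexed `k″ = k′ + 1`
  have hmain' : ∑ k' ∈ Ico 1 k, c * P k' / U ≤ ∑ k' ∈ Ico 1 k, a * χ ^ (k - k') * db (k' + 1) :=
    Finset.sum_le_sum fun k' hk' => by
      obtain ⟨h1, h2⟩ := Finset.mem_Ico.1 hk'
      exact hmain k' h1 h2
  have hreidx : ∑ k' ∈ Ico 1 k, a * χ ^ (k - k') * db (k' + 1) = ∑ k'' ∈ Ico 2 (k + 1), a * χ ^ (k + 1 - k'') * db k'' := by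
    rw [← Finset.sum_Ico_add' (fun k'' => a * χ ^ (k + 1 - k'') * db k'') 1 k 1]
    refine Finset.sum_congr rfl fun k' _ => ?_
    rw [show k + 1 - (k' + 1) = k - k' by omega]
  have hsub : ∑ k'' ∈ Ico 2 (k + 1), a * χ ^ (k + 1 - k'') * db k'' ≤ ∑ k'' ∈ range (k + 1), a * χ ^ (k + 1 - k'') * db k'' := by
    refine Finset.sum_le_sum_of_subset_of_nonneg (fun x hx => ?_) (fun k'' _ _ => by have := hdb0 k''; positivity)
    rw [Finset.mem_Ico] at hx; rw [Finset.mem_range]; omega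
  linarith [hS', hmain', hreidx.le, hreidx.ge, hsub]

section Model

variable {L b M : ℕ} [NeZero L] [NeZero (b * L)] [NeZero M]

set_option maxHeartbeats 800000 in -- large statement
/-- **THE (Dμ) ROW IN TRACK-`0` FLOOR UNITS** (block `k ≥ 1`, `2 ≤ d`, degree `n + 1 = 2m`, depth `D₀ + r`, `2r ≤ D₀`): with the jump rows `cW k′` of the earlier
blocks under the envelope `cW k′ ≤ C_J·2^{dk−1−dk′}` (`1 ≤ k′ < k`), the earlier born differences in their units (`klLipBornDiffSup … d k′ (n+1) (R_out k′) ≤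
db (k′+1) m·ε·klLevUnitF β M 0 m (dk′)`, depths `R_out k′ ≤ D₀`, `db ≥ 0`), the scaled measured difference `32·Z^m·klLipInputDiffSup … d k (n+1) (D₀+r)/(ε·klLevUnitF β M 0 m (dk−1))`
is at most `Σ_{k″∈[0,k]} (2ZC_J²)^m·((32/2^m)^d)^{k+1−k″}·db k″ m` PLUS `32·Z^m/(ε·klLevUnitF β M 0 m (dk−1))` times the ROW SOURCE: the base `B₀`, the full block-`0`
summand (N13), and for `1 ≤ k′ < k` the far parts `cW^n·τ·klLipBornDiffSup … d k′ (n+1) 0` and the coarse born profiles.  (= `hrow` of `EngineV8.towerDiff_le_of_geomBudget`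
for `dμ k m = 32Z^m(dE_k m + …)` once the `G·(μF+μV)` part and the source are put into `sμ`.) -/
theorem lipDiffArray_row_le {β : ℝ} (hβ : 0 < β) (U μ : ℝ) (K : TrigPolyC4v) {d : ℕ} (hd : 2 ≤ d) {k : ℕ} (hk : 1 ≤ k)
    {n m : ℕ} (hq : 2 * m = n + 1) (D₀ r jr : ℕ) (hD₀ : 2 * r ≤ D₀)
    {ΛT : ℝ} {cW : ℕ → ℝ} (hΛT : 0 ≤ ΛT) (hΛr : ΛT ≤ klScale klE0 jr) (hcW : ∀ k', 0 ≤ cW k')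
    (hrow : ∀ k' ∈ range k, ∀ x, ∑ y', ‖klJump (b * L) M β μ K (d * k - 1) (d * k') x y'‖ *
      klScaleWt (b * L) M β jr {latticeLegPos (2 * (2 * M)) x, latticeLegPos (2 * (2 * M)) y'} ≤ cW k')
    (hcol : ∀ k' ∈ range k, ∀ y', ∑ x, ‖klJump (b * L) M β μ K (d * k - 1) (d * k') x y'‖ *
      klScaleWt (b * L) M β jr {latticeLegPos (2 * (2 * M)) x, latticeLegPos (2 * (2 * M)) y'} ≤ cW k')
    {CJ : ℝ} (hcWenv : ∀ k', 1 ≤ k' → k' < k → cW k' ≤ CJ * (2 : ℝ) ^ (d * k - 1 - d * k'))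
    {B₀ : ℝ} (hB₀ : 0 ≤ B₀)
    (hbase : ∀ (q : Fin (n + 1)) (w : SpaceTimeIdx (b * L) M × SectorLeg (sectorCount (d * k - 1))), w ∈ klDeepPins L (D₀ + r) →
      ∑ X ∈ univ.filter (fun X : Fin (n + 1) → SpaceTimeIdx (b * L) M × SectorLeg (sectorCount (d * k - 1)) => X q = w),
        ‖kernel ℂ (sectorPreimage β (klAnisoFamily (b * L) M β μ K klE0 (d * k - 1)) (klEffectiveAction (b * L) M β U μ K klE0 0) -
            klGlue L b M (sectorCount (d * k - 1))
              (sectorPreimage β (klAnisoFamily L M β μ K klE0 (d * k - 1)) (klEffectiveAction L M β U μ K klE0 0))) (n + 1) X‖ ≤ B₀)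
    {N Nfar : ℕ → ℝ} (hN0 : ∀ k', 0 ≤ N k') (hNfar0 : ∀ k', 0 ≤ Nfar k')
    (hN : ∀ k' ∈ range k, ∀ (q : Fin (n + 1)) (y : SpaceTimeIdx L M × SectorLeg (sectorCount (d * k'))),
      ∑ Y ∈ univ.filter (fun Y : Fin (n + 1) → SpaceTimeIdx L M × SectorLeg (sectorCount (d * k')) => Y q = y),
        ‖kernel ℂ (klLipBorn L M β U μ K d k') (n + 1) Y‖ ≤ N k')
    (hNfar : ∀ k' ∈ range k, ∀ (q : Fin (n + 1)) (y : SpaceTimeIdx L M × SectorLeg (sectorCount (d * k'))) (i : Fin (n + 1)),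
      ∑ Y ∈ univ.filter (fun Y : Fin (n + 1) → SpaceTimeIdx L M × SectorLeg (sectorCount (d * k')) =>
          Y q = y ∧ r < Torus.tnorm ((Y q).1.2 - (Y i).1.2)), ‖kernel ℂ (klLipBorn L M β U μ K d k') (n + 1) Y‖ ≤ Nfar k')
    (Rout : ℕ → ℕ) (hdepth : ∀ k', 1 ≤ k' → k' < k → Rout k' ≤ D₀)
    (db : ℕ → ℝ) (hdb0 : ∀ k'', 0 ≤ db k'')
    (hdb : ∀ k', 1 ≤ k' → k' < k →
      klLipBornDiffSup L b M β U μ K d k' (n + 1) (Rout k') ≤ db (k' + 1) * (imagTimeWeight β M * klLevUnitF β M 0 m (d * k')))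
    {Z : ℝ} (hZ : 0 ≤ Z) :
    32 * Z ^ m * klLipInputDiffSup L b M β U μ K d k (n + 1) (D₀ + r) / (imagTimeWeight β M * klLevUnitF β M 0 m (d * k - 1)) ≤
      (∑ k'' ∈ range (k + 1), (2 * Z * CJ ^ 2) ^ m * (((32 : ℝ) / 2 ^ m) ^ d) ^ (k + 1 - k'') * db k'') +
        32 * Z ^ m * (B₀ +
          (cW 0 ^ n * (cW 0 * klLipBornDiffSup L b M β U μ K d 0 (n + 1) D₀) +
            (cW 0 ^ n * (cW 0 / (1 + ΛT * ((r : ℝ) + 1)) * klLipBornDiffSup L b M β U μ K d 0 (n + 1) 0) +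
              (2 * cW 0 ^ n * (cW 0 / (1 + ΛT * ((r : ℝ) + 1))) * N 0 +
                n * cW 0 ^ n * (5 * (cW 0 / (1 + ΛT * ((r : ℝ) + 1))) * N 0 + 2 * cW 0 * Nfar 0)))) +
          ∑ k' ∈ Ico 1 k, (cW k' ^ n * (cW k' / (1 + ΛT * ((r : ℝ) + 1)) * klLipBornDiffSup L b M β U μ K d k' (n + 1) 0) +
            (2 * cW k' ^ n * (cW k' / (1 + ΛT * ((r : ℝ) + 1))) * N k' +
              n * cW k' ^ n * (5 * (cW k' / (1 + ΛT * ((r : ℝ) + 1))) * N k' + 2 * cW k' * Nfar k')))) /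
          (imagTimeWeight β M * klLevUnitF β M 0 m (d * k - 1)) := by
  have hx : 0 < imagTimeWeight β M := imagTimeWeight_pos_of_pos (M := M) hβ
  have hU : 0 < imagTimeWeight β M * klLevUnitF β M 0 m (d * k - 1) := mul_pos hx (klLevUnitF_pos hβ 0 m _)
  have hd1 : 1 ≤ d := by omega
  -- the row in absolute units, summands split into MAIN + REST
  set P : ℕ → ℝ := fun k' => cW k' ^ n * (cW k' * klLipBornDiffSup L b M β U μ K d k' (n + 1) D₀) with hP
  set Q : ℕ → ℝ := fun k' => cW k' ^ n * (cW k' / (1 + ΛT * ((r : ℝ) + 1)) * klLipBornDiffSup L b M β U μ K d k' (n + 1) 0) +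
    (2 * cW k' ^ n * (cW k' / (1 + ΛT * ((r : ℝ) + 1))) * N k' +
      n * cW k' ^ n * (5 * (cW k' / (1 + ΛT * ((r : ℝ) + 1))) * N k' + 2 * cW k' * Nfar k')) with hQ
  have hS := klLipInputDiffSup_le_remeasured_var (L := L) (b := b) (M := M) hβ U μ K hd k n D₀ r jr hD₀ hΛT hΛr hcW hrow hcol hB₀ hbase hN0 hNfar0 hN hNfar
  have hS' : klLipInputDiffSup L b M β U μ K d k (n + 1) (D₀ + r) ≤ B₀ + ∑ k' ∈ range k, (P k' + Q k') := by
    refine hS.trans (le_of_eq ?_)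
    congr 1
    refine Finset.sum_congr rfl fun k' _ => ?_
    simp only [hP, hQ]
    ring
  -- the main pieces in units
  have hmain : ∀ k', 1 ≤ k' → k' < k → (32 * Z ^ m) * P k' / (imagTimeWeight β M * klLevUnitF β M 0 m (d * k - 1)) ≤
      (2 * Z * CJ ^ 2) ^ m * (((32 : ℝ) / 2 ^ m) ^ d) ^ (k - k') * db (k' + 1) := by
    intro k' hk'1 hk'k
    have hc0 := hcW k'
    have hSb : klLipBornDiffSup L b M β U μ K d k' (n + 1) D₀ ≤ db (k' + 1) * (imagTimeWeight β M * klLevUnitF β M 0 m (d * k')) :=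
      (klLipBornDiffSup_anti β U μ K d k' (n + 1) (hdepth k' hk'1 hk'k)).trans (hdb k' hk'1 hk'k)
    have hU' : 0 < klLevUnitF β M 0 m (d * k') := klLevUnitF_pos hβ 0 m _
    have hcoef := jumpCoeff_le (β := β) (M := M) (m := m) hβ hd1 hk'k hZ hc0 (hcWenv k' hk'1 hk'k)
    have hpow : cW k' ^ n * cW k' = cW k' ^ (2 * m) := by rw [hq, pow_succ]
    calc (32 * Z ^ m) * P k' / (imagTimeWeight β M * klLevUnitF β M 0 m (d * k - 1))
        = (32 * Z ^ m * cW k' ^ (2 * m)) * klLipBornDiffSup L b M β U μ K d k' (n + 1) D₀ /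
            (imagTimeWeight β M * klLevUnitF β M 0 m (d * k - 1)) := by
          simp only [hP]; rw [← hpow]; ring
      _ ≤ (32 * Z ^ m * cW k' ^ (2 * m)) * (db (k' + 1) * (imagTimeWeight β M * klLevUnitF β M 0 m (d * k'))) /
            (imagTimeWeight β M * klLevUnitF β M 0 m (d * k - 1)) := by
          have h0 : 0 ≤ 32 * Z ^ m * cW k' ^ (2 * m) := by positivity
          exact div_le_div_of_nonneg_right (mul_le_mul_of_nonneg_left hSb h0) hU.le
      _ = (32 * Z ^ m * cW k' ^ (2 * m) * (klLevUnitF β M 0 m (d * k') / klLevUnitF β M 0 m (d * k - 1))) * db (k' + 1) := by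
          field_simp
      _ ≤ ((2 * Z * CJ ^ 2) ^ m * (((32 : ℝ) / 2 ^ m) ^ d) ^ (k - k')) * db (k' + 1) :=
          mul_le_mul_of_nonneg_right hcoef (hdb0 _)
  have hχ : (0 : ℝ) ≤ ((32 : ℝ) / 2 ^ m) ^ d := by positivity
  have ha : (0 : ℝ) ≤ (2 * Z * CJ ^ 2) ^ m := by positivity
  have h := row_units_le (S := klLipInputDiffSup L b M β U μ K d k (n + 1) (D₀ + r)) (B₀ := B₀) (c := 32 * Z ^ m) hk (by positivity) hU ha hχ hdb0 hS' hmain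
  refine (le_of_eq ?_).trans (h.trans (le_of_eq ?_))
  · ring
  · simp only [hP, hQ]

end Model

end Summit.HubbardSuperconductivity.HubbardSuperconductivity.Theorems.TwoVolumeLip

end
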